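import Mathlib
import HarnessLib
import Summits.QuantumAdvantage.QuantumAdvantage.Theses.SpikesNeedAddresses
import Literature.Computability.QuantumComplexity.BoundedIndependenceOracles
import Literature.Computability.QuantumComplexity.ForrelationLemma24Mem

/-!
# Birth skeleton — piece `PromiseOracleSimulation` of the `PromiseTransfer` split (stmt-QuantumAdvantage-10749 / -11702)

Aaronson–Ambainis Thm 23 RELATIVE TO A PROMISE-BQP ORACLE, made concrete: the promise problem is the tree's
`PromiseBQP`-complete QSIM (`qSimProblem`, membership PROVED: `AaronsonAmbainis2018_lemma24_mem_holds`), and the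
one ingredient the tree lacks on the hashing side is isolated:

* `stub_explicitKWiseHash` (M): EXPLICIT `k`-wise independent one-bit hash families on the strings of length `≤ m`,
  keyed by `t(k+m)` uniform bits and evaluated by ONE language in `P` (random polynomials of degree `< k` over
  `GF(2^(m+2))`, Vandermonde; the tree has Zhandry's Thm 3.1 `sum_acceptProb_eq_of_isKWiseIndepFamily` but, by its own
  docstring, not the construction of explicit families nor their complexity);
* `stub_qsimSimulation_of_hash` (XL, the crux of the line): granted explicit hashing and the Aaronson–Ambainis
  conjecture, ONE deterministic poly-time machine with oracle `A ⊕ g`, for every `g` answering QSIM correctly on its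
  promise, decides `F^A(x)` except on measure `≤ 1/(r(n)+1)`: the ROBUST Thm 21 greedy on the restricted acceptance
  polynomial `p_ρ` (halting test `Var ≶ τ` and influence tests `Inf_i ≶ w` asked with GAPS; potential
  `E_b SumInf(p|i←b) = SumInf(p) − Inf_i(p)`, every queried variable having `Inf ≥ w/2`, Markov cut-off at depth
  `⌈16d/(wδ)⌉`, Chebyshev at the halting leaves — the tree's `ClassicalSimulation.simTree_depth_error_le` with halved
  constants), the moments `E p_ρ`, `E p_ρ²`, `E p_ρ(Y)p_ρ(Y^i)` over a `4T`-wise independent hashed completion being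
  transition amplitudes of uniformly generated `{H, CCSIGN}` circuits (QSIM instances), and the influential variables
  found by BBBV query-mass prefix descent (`≤ 32T²/w` candidates per level).

Composition `PromiseOracleSimulation_of`: take `Q := qSimProblem` and the tree's membership theorem.
-/

set_option linter.dupNamespace false

namespace Summit.QuantumAdvantage.QuantumAdvantage.Cruxes.PromiseTransfer.BirthPromiseOracleSimulation

open Literature.Computability.Complexity Literature.Computability.Cryptography Literature.Computability.QuantumComplexity

/-- The piece, verbatim as filed. -/
def PromiseOracleSimulation : Prop :=
  (∃ (c : ℕ) (C : ℝ), 0 < C ∧ ∀ (N d : ℕ) (p : MvPolynomial (Fin N) ℝ) (ε : ℝ), let ev : (Fin N → Bool) → ℝ := fun x => MvPolynomial.eval (fun i => if x i then (1 : ℝ) else 0) p; let avg : ((Fin N → Bool) → ℝ) → ℝ := fun f => (∑ x : Fin N → Bool, f x) / (2 : ℝ) ^ N; 1 ≤ d → p.totalDegree ≤ d → (∀ x, 0 ≤ ev x ∧ ev x ≤ 1) → 0 < ε → ε ≤ (avg fun x => (ev x - avg ev) ^ 2) → ∃ i : Fin N, C * (ε / d) ^ c ≤ (avg fun x => (ev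 x - ev (Function.update x i (!x i))) ^ 2)) →
  ∀ F : QCircuitFamily cliffordT, F.IsUniform → ∀ r : Polynomial ℕ,
    ∃ Q ∈ Literature.Computability.Cryptography.PromiseBQP, ∃ (C : OracleAlg Bool) (q : Polynomial ℕ),
      C.IsPolyTime Computability.encodingBoolBool ∧
      (∀ (O : Oracle) (x : List Bool), ∀ y ∈ C.queries O (q.eval x.length) x, y.length ≤ q.eval x.length) ∧
      ∀ x : List Bool, 1 ≤ x.length → ∀ g : List Bool → Bool,
        (∀ v ∈ Q.yes, g v = true) → (∀ v ∈ Q.no, g v = false) →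
        (ProbabilityTheory.setBernoulli (Set.univ : Set (List Bool)) ⟨1 / 2, by norm_num, by norm_num⟩)
          {A : Set (List Bool) |
            (2 / 3 ≤ F.acceptProbOn A x ∧
              C.run (Oracle.ofLanguage {w : List Bool | ∃ v : List Bool, (w = false :: v ∧ v ∈ A) ∨ (w = true :: v ∧ g v = true)}) (q.eval x.length) x ≠ some true) ∨
            (F.acceptProbOn A x ≤ 1 / 3 ∧
              C.run (Oracle.ofLanguage {w : List Bool | ∃ v : List Bool, (w = false :: v ∧ v ∈ A) ∨ (w = true :: v ∧ g v = true)}) (q.eval x.length) x ≠ some false)}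
          ≤ ENNReal.ofReal (1 / (((r.eval x.length : ℕ) : ℝ) + 1))

/-- The Aaronson–Ambainis conjecture written out (verbatim the antecedent of the piece and of `PromiseTransfer`). -/
def AAConjInline : Prop :=
  (∃ (c : ℕ) (C : ℝ), 0 < C ∧ ∀ (N d : ℕ) (p : MvPolynomial (Fin N) ℝ) (ε : ℝ), let ev : (Fin N → Bool) → ℝ := fun x => MvPolynomial.eval (fun i => if x i then (1 : ℝ) else 0) p; let avg : ((Fin N → Bool) → ℝ) → ℝ := fun f => (∑ x : Fin N → Bool, f x) / (2 : ℝ) ^ N; 1 ≤ d → p.totalDegree ≤ d → (∀ x, 0 ≤ ev x ∧ ev x ≤ 1) → 0 < ε → ε ≤ (avg fun x => (ev x - avg ev) ^ 2) → ∃ i : Fin N, C * (ε / d) ^ c ≤ (avg fun x => (ev x - ev (Function.update x i (!x i))) ^ 2))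

/-- The conclusion of the piece for a GIVEN promise problem `Q` (verbatim the body, `∃ Q ∈ PromiseBQP` removed). -/
def SimulationWith (Q : PromiseProblem) : Prop :=
  ∀ F : QCircuitFamily cliffordT, F.IsUniform → ∀ r : Polynomial ℕ,
    ∃ (C : OracleAlg Bool) (q : Polynomial ℕ),
      C.IsPolyTime Computability.encodingBoolBool ∧
      (∀ (O : Oracle) (x : List Bool), ∀ y ∈ C.queries O (q.eval x.length) x, y.length ≤ q.eval x.length) ∧
      ∀ x : List Bool, 1 ≤ x.length → ∀ g : List Bool → Bool,
        (∀ v ∈ Q.yes, g v = true) → (∀ v ∈ Q.no, g v = false) →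
        (ProbabilityTheory.setBernoulli (Set.univ : Set (List Bool)) ⟨1 / 2, by norm_num, by norm_num⟩)
          {A : Set (List Bool) |
            (2 / 3 ≤ F.acceptProbOn A x ∧
              C.run (Oracle.ofLanguage {w : List Bool | ∃ v : List Bool, (w = false :: v ∧ v ∈ A) ∨ (w = true :: v ∧ g v = true)}) (q.eval x.length) x ≠ some true) ∨
            (F.acceptProbOn A x ≤ 1 / 3 ∧
              C.run (Oracle.ofLanguage {w : List Bool | ∃ v : List Bool, (w = false :: v ∧ v ∈ A) ∨ (w = true :: v ∧ g v = true)}) (q.eval x.length) x ≠ some false)}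
          ≤ ENNReal.ofReal (1 / (((r.eval x.length : ℕ) : ℝ) + 1))

/-- EXPLICIT `k`-wise independent hashing in `P`: one language `H ∈ P` and a key-length polynomial `t` such that for
all `k, m`, the family `key ↦ {u | ⟨⟨1ᵏ, key⟩, u⟩ ∈ H}` over uniform keys of `t(k+m)` bits is `k`-wise independent
(tree predicate `IsKWiseIndepFamily`) on the strings of length `≤ m`. -/
def ExplicitKWiseHash : Prop :=
  ∃ H ∈ Literature.Computability.Complexity.Classes.P, ∃ t : Polynomial ℕ, ∀ k m : ℕ,
    IsKWiseIndepFamily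
      (fun key : Fin (t.eval (k + m)) → Bool =>
        {u : List Bool | Literature.Computability.Complexity.boolPair
          (Literature.Computability.Complexity.boolPair (List.replicate k true) (List.ofFn key)) u ∈ H})
      (shortStrings (m + 1)) k

/-- STUB 1 (M): explicit `k`-wise independent hash families evaluated in `P`. -/
theorem stub_explicitKWiseHash : ExplicitKWiseHash := by
  sorry

/-- STUB 2 (XL, the crux of the line): QSIM-oracle average-case simulation of uniform quantum oracle families under the
Aaronson–Ambainis conjecture, granted explicit hashing. -/
theorem stub_qsimSimulation_of_hash : ExplicitKWiseHash → AAConjInline → SimulationWith qSimProblem := by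
  sorry

/-- COMPOSITION (no sorry): `Q := qSimProblem`, in `PromiseBQP` by the tree theorem
`AaronsonAmbainis2018_lemma24_mem_holds`. -/
theorem PromiseOracleSimulation_of (h₁ : ExplicitKWiseHash)
    (h₂ : ExplicitKWiseHash → AAConjInline → SimulationWith qSimProblem) : PromiseOracleSimulation :=
  fun hAA F hU r => ⟨qSimProblem, AaronsonAmbainis2018_lemma24_mem_holds, h₂ h₁ hAA F hU r⟩

/-- The piece from the stubs. -/
theorem promiseOracleSimulation_holds_of_stubs : PromiseOracleSimulation :=
  PromiseOracleSimulation_of stub_explicitKWiseHash stub_qsimSimulation_of_hash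

end Summit.QuantumAdvantage.QuantumAdvantage.Cruxes.PromiseTransfer.BirthPromiseOracleSimulation
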